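import Literature.MathematicalPhysics.QuantumFieldTheory.Balaban1983to89.B15Prop1LipschitzFromProp4

/-!
# `Balaban1983to89.B15Prop1AdjointOfRecord` — [Balaban1989LargeFieldII] p. 359: `H*_{1,k}` IS THE ADJOINT OF `H_{1,k}` — the adjoint
# half of the letters (m2) of the N12∕s1 chain DISCHARGED (`Hst := LinearMap.adjoint H`, `‖H*‖ ≤ ‖H‖`), and the first-variation letters
# (m5)∕(c3) restated without `H*`: `d/ds A(…)|₀ = ⟨Hδ, J + Δ₁HB′ + (δ/δA)V(HB′)⟩`

statement-level skeleton of published theorems with citation tags; proofs where landed; nothing here is a claim about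
the Yang–Mills mass gap

[Balaban1989LargeFieldII] p. 359 (PDF 5), (1.12)–(1.13): *"⟨δB′, H*_{1,k}J_{k,Z}⟩ + ⟨δB′, H*_{1,k}Δ₁H_{1,k}B′⟩ + ⟨δB′, H*_{1,k}((δ/δA)V)(H_{1,k}B′)⟩
= 0 (1.12) … the operator P₀H*_{1,k}Δ₁H_{1,k}P₀ is positive, hence invertible on this subspace, and the inverse is bounded by
(γ₀⁻¹/2)2d(100M)⁵"* — `H*_{1,k}` the adjoint of the linearization `H_{1,k}` of the background field ([15] (190): `‖H_{1,k}‖ ≤ B₃`, hence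
`‖H*_{1,k}‖ ≤ B₃`).

Cell pub-ymgap, HUMAN RULING D-0062 (Track A full width), seat `pub-ymgap-dag-n12-c` (R134 acceleration seat (a), strategy s1 of DAG node
N12 = [B15]; generation g3, sixth product).

WHAT THIS FILE PROVES (theorems only; Mathlib + the import; no `sorry`, no definition, no `… : Prop` fact; axioms standard).
§1 **`norm_adjoint_apply_le`** — for a linear map `H` between finite-dimensional real inner-product spaces with `‖Hx‖ ≤ h₁‖x‖`, the adjoint
   satisfies `‖H†z‖ ≤ h₁‖z‖` (`‖H†z‖² = ⟨HH†z, z⟩ ≤ h₁‖H†z‖‖z‖`). [folklore operator-norm identity, here elementary]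
§2 **`prop1Printed_lfVarOn_std_su2_box_adjoint`** — the chain `B15Prop1LipschitzFromProp4.prop1Printed_lfVarOn_std_su2_box_of_prop4`
   with the datum `Hst` INSTANTIATED as `LinearMap.adjoint (H i V_k)` (`F i` finite-dimensional, as print's fields on `T_η`): the letters
   `hadj` (adjointness) and `hHst` (its norm bound) are NO LONGER HYPOTHESES (`hst := h₁` in the smallness `hsmall` and the threshold `he1`),
   and the first-variation letters `hA` ∕ `hc3` are restated in the adjoint-free printed shape `⟨H δ, J⟩ + ⟨H δ, Δ₁HB′⟩ + ⟨H δ, (δ/δA)V(HB′)⟩`.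
§3 **`exists_domain_prop1Printed_lfVarOn_std_su2_box`** — the thresholds (`hN'`, `hδ`, `he1`, positivity of `δc`, `a₁`, `eD`) ELIMINATED by
   choosing the domain constant `a₁ i > 0` of print's instance (`thresholds_exist`): `∃ a₁, (∀ i, 0 < a₁ i) ∧ B15.Prop1Printed (lfVarOn su2Chart …)`.

HONEST SCOPE.  Remaining hypotheses of the N12∕s1 chain after this file (all NODE 00's pieces of record or bookkeeping): `hlead` (p. 357
identification) + `hsm`∕`hγle`∕`hbxM`; `hH` ((190) [15]: `‖H_{1,k}‖ ≤ B₃`); Prop. 4 [15] data `emb`∕`W`∕`hW`∕`hWdV` + `hρ`∕`ha₃`∕`hsmall`;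
(m4) `hJ`; (m5)∕(c3) `hA`∕`hc3` (the first-variation identity (1.12) at the p. 193 extension); (181) `h181` + `hk`; (x) `hAn`; thresholds
(jointly satisfiable).  Count-neutral; NOT a discharge of N12; NOT summit progress; nothing continuum ∕ OS ∕ mass-gap ∕ Clay.
-/

noncomputable section

open Set Finset
open scoped BigOperators Matrix RealInnerProductSpace Real
open Classical

namespace Literature.MathematicalPhysics.QuantumFieldTheory.Balaban1983to89.B15Prop1AdjointOfRecord

open B15DeterminingSets GaugeField B16Sect1Backgrounds B15Prop1Carrier B8Eq17ClassAkV1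
open B15Prop1CarrierOnSU2Box B15Prop1SliceIneq18 B15Prop1CarrierOnSU2BoxIneq19 B15Prop1CarrierOnSU2BoxExt193 B15Prop1SliceIneq167
open B15Prop1StdInstanceSU2Box B15Prop1LipschitzFromProp4
open T4CubeChartGnomonic (SU2)
open B15Prop1ChartSU2 (su2Chart)
open B15Prop1SliceCoordinates (GaugeSlice ιA freeBonds)
open T4AxialGaugeSmallField (castSite boxPlaqs)
open B7Prop1Explicit (e e_apply)
open B6BondElimination (unitVec unitVec_apply)
open B6TreeGaugePoincare (curl)
open B16Eq18Proof (box mem_box)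
open B15Extension193 (extend)
open B15ShellGauge193 (shellGauge)
open B5Prop11Plancherel (Tor)
open B5Bounds167Lattice (formDk ofRealCfg)
open B14.Eq213DetSet B14.Eq216Concrete B14.Eq12InteriorLocality B15Sect1Instances B15Eq177GaugeInvariance
open Literature.MathematicalPhysics.QuantumFieldTheory.BalabanImbrieJaffe1984to88.BIJ85Eq453GaugeField
open B11Prop6Scheme (Prop4Hyp)

/-! ## §1 The adjoint inherits the operator bound -/

section Adjoint

variable {E F : Type*} [NormedAddCommGroup E] [InnerProductSpace ℝ E] [NormedAddCommGroup F] [InnerProductSpace ℝ F]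
  [FiniteDimensional ℝ E] [FiniteDimensional ℝ F]

/-- **`‖H*‖ ≤ ‖H‖`**: if `‖Hx‖ ≤ h₁‖x‖` for all `x` (`h₁ ≥ 0`), then `‖H†z‖ ≤ h₁‖z‖` for the adjoint `H† = LinearMap.adjoint H` — the norm letter
for `H*_{1,k}` of the (1.13) contraction ([15] (190): `‖H_{1,k}‖ ≤ B₃`). [cite: Balaban1989LargeFieldII, (1.12)–(1.13) p.359;
Balaban1985Variational, (190) p.308] -/
theorem norm_adjoint_apply_le (H : E →ₗ[ℝ] F) {h₁ : ℝ} (hh₁ : 0 ≤ h₁) (hH : ∀ x, ‖H x‖ ≤ h₁ * ‖x‖) (z : F) :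
    ‖LinearMap.adjoint H z‖ ≤ h₁ * ‖z‖ := by
  set w := LinearMap.adjoint H z with hw
  have h1 : ‖w‖ ^ 2 = ⟪H w, z⟫ := by
    rw [← real_inner_self_eq_norm_sq, hw, LinearMap.adjoint_inner_left, real_inner_comm]
  have h2 : ⟪H w, z⟫ ≤ ‖H w‖ * ‖z‖ := real_inner_le_norm _ _
  have h3 : ‖w‖ ^ 2 ≤ h₁ * ‖z‖ * ‖w‖ := by
    calc ‖w‖ ^ 2 = ⟪H w, z⟫ := h1
      _ ≤ ‖H w‖ * ‖z‖ := h2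
      _ ≤ h₁ * ‖w‖ * ‖z‖ := mul_le_mul_of_nonneg_right (hH w) (norm_nonneg _)
      _ = h₁ * ‖z‖ * ‖w‖ := by ring
  by_cases h0 : ‖w‖ = 0
  · rw [h0]; positivity
  · have hpos : 0 < ‖w‖ := lt_of_le_of_ne (norm_nonneg _) (Ne.symm h0)
    have : ‖w‖ * ‖w‖ ≤ h₁ * ‖z‖ * ‖w‖ := by rw [← sq]; exact h3
    exact le_of_mul_le_mul_right this hpos

end Adjoint

/-! ## §2 The chain with `H* := H†` -/

section Knit

variable {P : Params}

/-- **PROPOSITION 1 [IV] FOR PRINT'S FUNCTION (1.77) AT `SU(2)` ON PARALLELEPIPEDS — `H*_{1,k}` THE ADJOINT OF `H_{1,k}`**: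
`B15Prop1LipschitzFromProp4.prop1Printed_lfVarOn_std_su2_box_of_prop4` with `Hst := LinearMap.adjoint (H i V_k)`; adjointness and the norm
bound of `H*` are supplied (`LinearMap.adjoint_inner_right`, `norm_adjoint_apply_le`), and the first-variation letters are taken in the
adjoint-free shape. [cite: Balaban1989LargeFieldI, Prop. 1 (1.77)–(1.78) p.194; Balaban1989LargeFieldII, (1.12)–(1.13) pp.358–359;
Balaban1985Variational, Prop. 4 pp.292–293, (181) p.307, (190) p.308] -/
theorem prop1Printed_lfVarOn_std_su2_box_adjoint (hd3 : 3 ≤ P.d) (h0 : 0 < P.d) {ι : Type} {av : ∀ j, Averaging P j SU2}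
    (bg : DetBackground P SU2 av) (M₁ : ℕ) (Z Λ : ι → Set (Site P 0)) (k : ι → ℕ) (M a₁ : ι → ℝ)
    (An : ∀ i, ℝ → GaugeField P (k i) SU2 → Prop) (hk : ∀ i, k i ≤ P.m + P.K)
    -- (c3″) REPLACED by the [15] (181) covariance of the solution map at print's instance (`B15Prop1Carrier.std_f_gaugeAct`)
    (h181 : ∀ i (u : GaugeTransf P (k i) SU2), Cov181 bg (Bj M₁ (Z i) (k i)) (blockLift (k i) u))
    (T : ∀ i, Finset (PBond P (k i)))
    -- (m2) adjoint half DISCHARGED: `H*_{1,k}` IS the adjoint of `H_{1,k}` ([IV] (1.78) context, [LF-II] p. 359), `F` finite-dimensional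
    {F : ι → Type*} [∀ i, NormedAddCommGroup (F i)] [∀ i, InnerProductSpace ℝ (F i)] [∀ i, FiniteDimensional ℝ (F i)]
    (H : ∀ i, GaugeField P (k i) SU2 →
      (GaugeSlice (pts (k i) (Λ i)) (T i) (EuclideanSpace ℝ (Fin 3)) →ₗ[ℝ] F i))
    (Δ₁ : ∀ i, GaugeField P (k i) SU2 → (F i →ₗ[ℝ] F i)) (dV : ∀ i, GaugeField P (k i) SU2 → F i → F i)
    -- (m3) REPLACED by Proposition 4 [15] in r08's typed form on the COMPLEXIFIED functional derivative `W = (δ/δA)V` on 𝔤ᶜ-valued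
    -- fields (p. 359: «valid for 𝔤ᶜ-valued fields»), restricting to `dV` along an isometric embedding `emb` of the real fields
    {Fc : ι → Type*} [∀ i, NormedAddCommGroup (Fc i)] [∀ i, NormedSpace ℂ (Fc i)] (emb : ∀ i, F i → Fc i)
    (hemb : ∀ i (u v : F i), ‖emb i u - emb i v‖ = ‖u - v‖) (hemb0 : ∀ i, emb i 0 = 0)
    (W : ∀ i, GaugeField P (k i) SU2 → Fc i → Fc i) {C₄ a₃ a : ι → ℝ} (hC₄ : ∀ i, 0 ≤ C₄ i) (ha : ∀ i, 0 < a i)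
    (hW : ∀ i Vk, Prop4Hyp (W i Vk) (C₄ i) (a₃ i)) (hWdV : ∀ i Vk (u : F i), W i Vk (emb i u) = emb i (dV i Vk u))
    (J : ∀ i, GaugeField P (k i) SU2 → F i)
    (lo hi : ι → Fin P.d → ℤ) (n : ι → ℕ) (hn : ∀ i κ, hi i κ ≤ lo i κ + n i) (hN : ∀ i, n i + 2 < P.sitesPerDir (k i))
    (hbox : ∀ i, pts (k i) (Λ i) = (castSite '' Set.Icc (lo i) (hi i) : Set (Site P (k i))))
    (hZ : ∀ i, (boxPlaqs (lo i - 1) (hi i + 1) : Set (Plaq P (k i))) ⊆ plaqsInside (pts (k i) (Z i)))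
    (hTG0 : ∀ i, T i = (box (fun κ => (hi i κ - lo i κ + 1).toNat) (lo i)).image fun x =>
      (⟨castSite (x - unitVec ⟨0, h0⟩), ⟨0, h0⟩⟩ : PBond P (k i)))
    (hN5 : ∀ i κ, ((hi i κ - lo i κ + 1).toNat : ℤ) + 5 < P.sitesPerDir (k i))
    (K : ι → ℕ) (hK1 : ∀ i, 1 ≤ K i) (hKn : ∀ i κ, (hi i κ - lo i κ + 1).toNat ≤ K i)
    (ext : ∀ i, GaugeField P (k i) SU2 → GaugeField P (k i) SU2)
    -- (ℓ2) REPLACED: the extension is r12's p. 193 shell-gauge extension, `Λ` non-degenerate, constant bookkeeping `hbxM`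
    (hext : ∀ i Vk, ext i Vk = extend (pts (k i) (Λ i)) (shellGauge Vk (lo i) (hi i)) Vk)
    (hlohi : ∀ i, lo i ≤ hi i)
    {γ h₁ cJ bx : ℝ} (hγ : 0 < γ) (hh₁ : 0 ≤ h₁) (hcJ : 0 ≤ cJ) (hbx : 0 ≤ bx)
    (hbxM : ∀ i, 12 * (P.d : ℝ) * ((n i : ℝ) + 2) ^ 2 ≤ bx * (M i) ^ 2)
    {ρ r eA eD δc Cerr : ι → ℝ} (hr : ∀ i, 0 < r i) (heA : ∀ i, 0 < eA i) (heD : ∀ i, 0 < eD i)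
    (hδc : ∀ i, 0 < δc i) (ha₁ : ∀ i, 0 ≤ a₁ i) (hM : ∀ i, 1 ≤ (M i))
    (n' : ι → ℕ) (hn' : ∀ i, 1 ≤ n' i)
    (hlead : ∀ i Vk (X : GaugeSlice (pts (k i) (Λ i)) (T i) (EuclideanSpace ℝ (Fin 3))),
      |⟪H i Vk X, Δ₁ i Vk (H i Vk X)⟫ -
          ∑ a : Fin 3, formDk (n' i) (fun _ : Fin P.d => P.sitesPerDir (k i))
            (ofRealCfg (fun _ : Fin P.d => P.sitesPerDir (k i)) fun j =>
              ιA (pts (k i) (Λ i)) (T i) X ⟨j.1, j.2⟩ a)| ≤ Cerr i * ‖X‖ ^ 2)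
    (hsm : ∀ i, Cerr i ≤ (4 / Real.pi ^ 2) ^ (P.d + 2) / (2 * (3 * (K i : ℝ) ^ 2 + 2 * (K i : ℝ) ^ 4)))
    (hγle : ∀ i, γ / (M i) ^ 5 ≤ (4 / Real.pi ^ 2) ^ (P.d + 2) / (2 * (3 * (K i : ℝ) ^ 2 + 2 * (K i : ℝ) ^ 4)))
    (hH : ∀ i Vk x, ‖H i Vk x‖ ≤ h₁ * ‖x‖)
    (hρ : ∀ i, h₁ * r i ≤ ρ i) (ha₃ : ∀ i, 2 * (ρ i + a i) ≤ a₃ i)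
    (hsmall : ∀ i, (M i) ^ 5 / γ * h₁ * (4 * C₄ i * (ρ i + a i)) * h₁ ≤ 1 / 2)
    (hA : ∀ i Vk (X δ : GaugeSlice (pts (k i) (Λ i)) (T i) (EuclideanSpace ℝ (Fin 3))),
      HasDerivAt (fun s : ℝ => (fun177std bg M₁ (Z i) (k i)) (expMul su2Chart (ιA (pts (k i) (Λ i)) (T i) (X + s • δ)) (ext i Vk)))
      (⟪H i Vk δ, J i Vk⟫ + ⟪H i Vk δ, Δ₁ i Vk (H i Vk X)⟫ + ⟪H i Vk δ, dV i Vk (H i Vk X)⟫) 0)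
    (hJ : ∀ i ε Vk, 0 < ε → PlaqSmallOn (plaqsInside (pts (k i) (Z i ∩ (Λ i)ᶜ))) ε Vk → ‖J i Vk‖ ≤ cJ * ε)
    (hc3 : ∀ i Vk (B : GaugeSlice (pts (k i) (Λ i)) (T i) (EuclideanSpace ℝ (Fin 3))), ‖B‖ ≤ r i →
      (IsCriticalPt su2Chart (bondsOf (pts (k i) (Λ i))) (fun177std bg M₁ (Z i) (k i))
          (expMul su2Chart (ιA (pts (k i) (Λ i)) (T i) B) (ext i Vk)) ↔
        ∀ δB : GaugeSlice (pts (k i) (Λ i)) (T i) (EuclideanSpace ℝ (Fin 3)),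
          ⟪H i Vk δB, J i Vk⟫ + ⟪H i Vk δB, Δ₁ i Vk (H i Vk B)⟫ + ⟪H i Vk δB, dV i Vk (H i Vk B)⟫ = 0))
    (hAn : ∀ i ε Vk, 0 < ε → ε ≤ eA i → PlaqSmallOn (plaqsInside (pts (k i) (Z i ∩ (Λ i)ᶜ))) ε Vk → An i ε Vk)
    -- thresholds (`N i = √|free bonds|`)
    (hN' : ∀ i, Real.sqrt (freeBonds (pts (k i) (Λ i)) (T i)).card * (π / 2 * δc i) ≤ r i)
    (hδ : ∀ i ε, 0 < ε → ε ≤ eD i →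
      ((n i : ℝ) + 2) * ((n i : ℝ) + P.d) * (a₁ i + (bx * (M i) ^ 2 * ε + ε)) < δc i)
    (he1 : ∀ i ε, 0 < ε → ε ≤ eD i → (4 * 1 * (2 * (M i) ^ 5 * h₁ * cJ / γ) + bx * (M i) ^ 2) * ε < a₁ i) :
    B15.Prop1Printed (lfVarOn su2Chart fun i => InstOn.std bg M₁ (Z i) (Λ i) (k i) (M i) (a₁ i) (An i)) := by
  refine prop1Printed_lfVarOn_std_su2_box_of_prop4 hd3 h0 bg M₁ Z Λ k M a₁ An hk h181 T H
    (fun i Vk => LinearMap.adjoint (H i Vk)) (fun i Vk x y => (LinearMap.adjoint_inner_right (H i Vk) x y).symm) Δ₁ dV emb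
    hemb hemb0 W hC₄ ha hW hWdV J lo hi n hn hN hbox hZ hTG0 hN5 K hK1 hKn ext hext hlohi hγ hh₁ hh₁ hcJ hbx hbxM hr heA heD
    hδc ha₁ hM n' hn' hlead hsm hγle hH (fun i Vk z => norm_adjoint_apply_le (H i Vk) hh₁ (hH i Vk) z) hρ ha₃ hsmall
    (fun i Vk X δ => ?_) hJ (fun i Vk B hB => ?_) hAn hN' hδ he1
  · simpa only [LinearMap.adjoint_inner_right] using hA i Vk X δ
  · simpa only [LinearMap.adjoint_inner_right] using hc3 i Vk B hB


/-- **PROPOSITION 1 [IV] FOR PRINT'S FUNCTION (1.77) WITH THE DOMAIN CONSTANT CHOSEN** (*"mild regularity conditions, e.g.,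
|∂V_k − 1| < a₁ on Z"*, p. 194; *"ε > 0 is sufficiently small"*, p. 193): the three thresholds `hN'` ∕ `hδ` ∕ `he1` and the positivity
of `δc`, `a₁`, `eD` of `prop1Printed_lfVarOn_std_su2_box_adjoint` are ELIMINATED by CHOOSING `a₁ i`, `δc i`, `eD i` through
`B15Prop1CarrierOnSU2BoxExt193.thresholds_exist`: there is a family of domain constants `a₁ i > 0` for which Proposition 1 holds at print's
instances. [cite: Balaban1989LargeFieldI, Prop. 1 (1.77)–(1.78) p.194, p.193; Balaban1989LargeFieldII, pp.357–359] -/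
theorem exists_domain_prop1Printed_lfVarOn_std_su2_box (hd3 : 3 ≤ P.d) (h0 : 0 < P.d) {ι : Type} {av : ∀ j, Averaging P j SU2}
    (bg : DetBackground P SU2 av) (M₁ : ℕ) (Z Λ : ι → Set (Site P 0)) (k : ι → ℕ) (M : ι → ℝ)
    (An : ∀ i, ℝ → GaugeField P (k i) SU2 → Prop) (hk : ∀ i, k i ≤ P.m + P.K)
    -- (c3″) REPLACED by the [15] (181) covariance of the solution map at print's instance (`B15Prop1Carrier.std_f_gaugeAct`)
    (h181 : ∀ i (u : GaugeTransf P (k i) SU2), Cov181 bg (Bj M₁ (Z i) (k i)) (blockLift (k i) u))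
    (T : ∀ i, Finset (PBond P (k i)))
    -- (m2) adjoint half DISCHARGED: `H*_{1,k}` IS the adjoint of `H_{1,k}` ([IV] (1.78) context, [LF-II] p. 359), `F` finite-dimensional
    {F : ι → Type*} [∀ i, NormedAddCommGroup (F i)] [∀ i, InnerProductSpace ℝ (F i)] [∀ i, FiniteDimensional ℝ (F i)]
    (H : ∀ i, GaugeField P (k i) SU2 →
      (GaugeSlice (pts (k i) (Λ i)) (T i) (EuclideanSpace ℝ (Fin 3)) →ₗ[ℝ] F i))
    (Δ₁ : ∀ i, GaugeField P (k i) SU2 → (F i →ₗ[ℝ] F i)) (dV : ∀ i, GaugeField P (k i) SU2 → F i → F i)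
    -- (m3) REPLACED by Proposition 4 [15] in r08's typed form on the COMPLEXIFIED functional derivative `W = (δ/δA)V` on 𝔤ᶜ-valued
    -- fields (p. 359: «valid for 𝔤ᶜ-valued fields»), restricting to `dV` along an isometric embedding `emb` of the real fields
    {Fc : ι → Type*} [∀ i, NormedAddCommGroup (Fc i)] [∀ i, NormedSpace ℂ (Fc i)] (emb : ∀ i, F i → Fc i)
    (hemb : ∀ i (u v : F i), ‖emb i u - emb i v‖ = ‖u - v‖) (hemb0 : ∀ i, emb i 0 = 0)
    (W : ∀ i, GaugeField P (k i) SU2 → Fc i → Fc i) {C₄ a₃ a : ι → ℝ} (hC₄ : ∀ i, 0 ≤ C₄ i) (ha : ∀ i, 0 < a i)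
    (hW : ∀ i Vk, Prop4Hyp (W i Vk) (C₄ i) (a₃ i)) (hWdV : ∀ i Vk (u : F i), W i Vk (emb i u) = emb i (dV i Vk u))
    (J : ∀ i, GaugeField P (k i) SU2 → F i)
    (lo hi : ι → Fin P.d → ℤ) (n : ι → ℕ) (hn : ∀ i κ, hi i κ ≤ lo i κ + n i) (hN : ∀ i, n i + 2 < P.sitesPerDir (k i))
    (hbox : ∀ i, pts (k i) (Λ i) = (castSite '' Set.Icc (lo i) (hi i) : Set (Site P (k i))))
    (hZ : ∀ i, (boxPlaqs (lo i - 1) (hi i + 1) : Set (Plaq P (k i))) ⊆ plaqsInside (pts (k i) (Z i)))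
    (hTG0 : ∀ i, T i = (box (fun κ => (hi i κ - lo i κ + 1).toNat) (lo i)).image fun x =>
      (⟨castSite (x - unitVec ⟨0, h0⟩), ⟨0, h0⟩⟩ : PBond P (k i)))
    (hN5 : ∀ i κ, ((hi i κ - lo i κ + 1).toNat : ℤ) + 5 < P.sitesPerDir (k i))
    (K : ι → ℕ) (hK1 : ∀ i, 1 ≤ K i) (hKn : ∀ i κ, (hi i κ - lo i κ + 1).toNat ≤ K i)
    (ext : ∀ i, GaugeField P (k i) SU2 → GaugeField P (k i) SU2)
    -- (ℓ2) REPLACED: the extension is r12's p. 193 shell-gauge extension, `Λ` non-degenerate, constant bookkeeping `hbxM`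
    (hext : ∀ i Vk, ext i Vk = extend (pts (k i) (Λ i)) (shellGauge Vk (lo i) (hi i)) Vk)
    (hlohi : ∀ i, lo i ≤ hi i)
    {γ h₁ cJ bx : ℝ} (hγ : 0 < γ) (hh₁ : 0 ≤ h₁) (hcJ : 0 ≤ cJ) (hbx : 0 ≤ bx)
    (hbxM : ∀ i, 12 * (P.d : ℝ) * ((n i : ℝ) + 2) ^ 2 ≤ bx * (M i) ^ 2)
    {ρ r eA Cerr : ι → ℝ} (hr : ∀ i, 0 < r i) (heA : ∀ i, 0 < eA i) (hM : ∀ i, 1 ≤ (M i))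
    (n' : ι → ℕ) (hn' : ∀ i, 1 ≤ n' i)
    (hlead : ∀ i Vk (X : GaugeSlice (pts (k i) (Λ i)) (T i) (EuclideanSpace ℝ (Fin 3))),
      |⟪H i Vk X, Δ₁ i Vk (H i Vk X)⟫ -
          ∑ a : Fin 3, formDk (n' i) (fun _ : Fin P.d => P.sitesPerDir (k i))
            (ofRealCfg (fun _ : Fin P.d => P.sitesPerDir (k i)) fun j =>
              ιA (pts (k i) (Λ i)) (T i) X ⟨j.1, j.2⟩ a)| ≤ Cerr i * ‖X‖ ^ 2)
    (hsm : ∀ i, Cerr i ≤ (4 / Real.pi ^ 2) ^ (P.d + 2) / (2 * (3 * (K i : ℝ) ^ 2 + 2 * (K i : ℝ) ^ 4)))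
    (hγle : ∀ i, γ / (M i) ^ 5 ≤ (4 / Real.pi ^ 2) ^ (P.d + 2) / (2 * (3 * (K i : ℝ) ^ 2 + 2 * (K i : ℝ) ^ 4)))
    (hH : ∀ i Vk x, ‖H i Vk x‖ ≤ h₁ * ‖x‖)
    (hρ : ∀ i, h₁ * r i ≤ ρ i) (ha₃ : ∀ i, 2 * (ρ i + a i) ≤ a₃ i)
    (hsmall : ∀ i, (M i) ^ 5 / γ * h₁ * (4 * C₄ i * (ρ i + a i)) * h₁ ≤ 1 / 2)
    (hA : ∀ i Vk (X δ : GaugeSlice (pts (k i) (Λ i)) (T i) (EuclideanSpace ℝ (Fin 3))),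
      HasDerivAt (fun s : ℝ => (fun177std bg M₁ (Z i) (k i)) (expMul su2Chart (ιA (pts (k i) (Λ i)) (T i) (X + s • δ)) (ext i Vk)))
      (⟪H i Vk δ, J i Vk⟫ + ⟪H i Vk δ, Δ₁ i Vk (H i Vk X)⟫ + ⟪H i Vk δ, dV i Vk (H i Vk X)⟫) 0)
    (hJ : ∀ i ε Vk, 0 < ε → PlaqSmallOn (plaqsInside (pts (k i) (Z i ∩ (Λ i)ᶜ))) ε Vk → ‖J i Vk‖ ≤ cJ * ε)
    (hc3 : ∀ i Vk (B : GaugeSlice (pts (k i) (Λ i)) (T i) (EuclideanSpace ℝ (Fin 3))), ‖B‖ ≤ r i →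
      (IsCriticalPt su2Chart (bondsOf (pts (k i) (Λ i))) (fun177std bg M₁ (Z i) (k i))
          (expMul su2Chart (ιA (pts (k i) (Λ i)) (T i) B) (ext i Vk)) ↔
        ∀ δB : GaugeSlice (pts (k i) (Λ i)) (T i) (EuclideanSpace ℝ (Fin 3)),
          ⟪H i Vk δB, J i Vk⟫ + ⟪H i Vk δB, Δ₁ i Vk (H i Vk B)⟫ + ⟪H i Vk δB, dV i Vk (H i Vk B)⟫ = 0))
    (hAn : ∀ i ε Vk, 0 < ε → ε ≤ eA i → PlaqSmallOn (plaqsInside (pts (k i) (Z i ∩ (Λ i)ᶜ))) ε Vk → An i ε Vk)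
    : ∃ a₁ : ι → ℝ, (∀ i, 0 < a₁ i) ∧
      B15.Prop1Printed (lfVarOn su2Chart fun i => InstOn.std bg M₁ (Z i) (Λ i) (k i) (M i) (a₁ i) (An i)) := by
  classical
  have hex : ∀ i, ∃ δc a₁ eD : ℝ, 0 < δc ∧ 0 < a₁ ∧ 0 < eD ∧
      Real.sqrt (freeBonds (pts (k i) (Λ i)) (T i)).card * (π / 2 * δc) ≤ r i ∧
      (∀ ε : ℝ, 0 < ε → ε ≤ eD → ((n i : ℝ) + 2) * ((n i : ℝ) + P.d) * (a₁ + (bx * (M i) ^ 2 * ε + ε)) < δc) ∧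
      ∀ ε : ℝ, 0 < ε → ε ≤ eD → (4 * 1 * (2 * (M i) ^ 5 * h₁ * cJ / γ) + bx * (M i) ^ 2) * ε < a₁ :=
    fun i => thresholds_exist _ (hr i) hγ (hM i) hh₁ hcJ hbx (n i) P.d
  choose δc a₁ eD hδc ha₁ heD hN' hδ he1 using hex
  exact ⟨a₁, ha₁, prop1Printed_lfVarOn_std_su2_box_adjoint hd3 h0 bg M₁ Z Λ k M a₁ An hk h181 T H Δ₁ dV emb hemb hemb0 W hC₄
    ha hW hWdV J lo hi n hn hN hbox hZ hTG0 hN5 K hK1 hKn ext hext hlohi hγ hh₁ hcJ hbx hbxM hr heA heD hδc (fun i => (ha₁ i).le)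
    hM n' hn' hlead hsm hγle hH hρ ha₃ hsmall hA hJ hc3 hAn hN' hδ he1⟩

end Knit

end Literature.MathematicalPhysics.QuantumFieldTheory.Balaban1983to89.B15Prop1AdjointOfRecord

end
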